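import Literature.Analysis.FluidPDE.TorusNSBealeKatoMajda
import Literature.Analysis.FluidPDE.ExtremeGrowthVorticityControl
import Literature.Analysis.FluidPDE.TorusClassicalH1Balance
import Literature.Analysis.FunctionSpaces.TorusSupNormContinuity
import HarnessLib

/-!
# Fluid computer — VORTICITY-RATIO CONTINUATION on `T³` (R2 amplitude rung, the `m = ∞` chessboard endpoint)

HONEST FRAMING (cell `pub-fluidc`, verbatim): *low prior, high value-of-information experiment on Tao's
machine paradigm; NOT a claim that NS blows up.* A continuation criterion and its blow-up contrapositive for
classical solutions on the periodic box — the theorem side of the cell; nothing here is evidence of blow-up.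

The cell's idea-2 seat (HOME/pub-fluidc-idea-2/SKETCH-R2-chessboard.lean, CARD O5 `VorticityRatioContinuation`)
typed the `m = ∞` endpoint of the Donzis–Gibbon "chessboard" of vorticity moments as a continuation criterion:
a classical mean-zero solution of the unforced Navier–Stokes equations on `[0, T) × T³`, `ν > 0`, whose
POINTWISE vorticity is dominated by a fixed multiple of its ENSTROPHY, `|ω(t, x)|² ≤ (K ℰ(u(t)))²`, continues
past `T`. It is proved here from the tree's periodic Beale–Kato–Majda criterion
`Torus.classicalNS_bkm_continuation` (Robinson–Rodrigo–Sadowski 2016, Thm. 12.3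
[cite: RobinsonRodrigoSadowskiCUP2016, Thm 12.3]) with the majorant `M(t) = K ℰ(u(t)) + C`, whose primitive is
bounded by the energy identity `2ν ∫₀ᵗ ℰ ≤ ½‖u(0)‖²` (`two_mul_integral_torusEnstrophy_le_kineticEnergy`):

* `continuousOn_torusEnstrophy` — the enstrophy is continuous along a classical solution on `[0, T)` (from the
  enstrophy balance `IsClassicalNSSolutionOn.hasDerivWithinAt_half_gradNormSq` on closed sub-slabs);
* `continuation_of_vorticity_le_affine_enstrophy` — majorant `K ℰ(u t) + C`, `K, C ≥ 0` ⇒ continuation past `T`;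
* `vorticityRatioContinuation` — the statement exactly as typed by idea-2 (`C = 0`);
* `vorticityRatioFloor_affine` — blow-up form: if the solution does not continue past `T`, then for every
  `K, C ≥ 0` some `(t, x) ∈ [0, T) × T³` has `|ω(t, x)|² > (K ℰ(u t) + C)²` — the machine's ratio
  `‖ω(t)‖_∞ / ℰ(u(t))` is unbounded on `[0, T)` even after subtracting any constant `C`.

* `exists_vorticitySq_le_on_Icc` — on a closed early slab `[0, b] × T³`, `b < T`, the pointwise vorticity of
  a classical solution is bounded (joint smoothness: the sup norms of the spatial derivatives are continuous in
  time, `Torus.IsSmoothSpaceTimeOn.continuousOn_toReal_eSupNorm`, hence bounded on the compact `[0, b]`;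
  `|ω|² ≤ 2 ∑ᵢ ‖∂ᵢ u‖²`);
* `vorticityRatioFloor` — idea-2's second typed statement (`VorticityRatioFloor`, verbatim body): if the
  solution does not continue past `T`, then for every `K` and every `δ > 0` some time `t ∈ [0, T)` with
  `T − δ ≤ t` and some `x` have `|ω(t, x)|² > (K ℰ(u t))²` — `limsup_{t → T} ‖ω(t)‖_∞ / ℰ(u(t)) = +∞` along a
  blow-up: the affine floor with `C := sup_{[0, T−δ] × T³} |ω|`.

0 sorry; axioms ⊆ {propext, Classical.choice, Quot.sound}; no def, no named fact.

## References

* J. T. Beale, T. Kato, A. Majda, Comm. Math. Phys. 94 (1984) 61–66. [BealeKatoMajda1984]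
* J. C. Robinson, J. L. Rodrigo, W. Sadowski, *The Three-Dimensional Navier–Stokes Equations*, CUP 2016,
  Thm 12.3 (with Thm 6.8, Lemma 6.11 on `T³`). [RobinsonRodrigoSadowskiCUP2016]
* D. A. Donzis, J. D. Gibbon et al., J. Fluid Mech. 732 (2013) — the `D_m` hierarchy whose `m = ∞` endpoint
  the idea-2 card reads (context only; not cited as a source of any statement here).
-/

noncomputable section

open MeasureTheory Set Function Filter Topology
open scoped ENNReal NNReal
open Literature.Analysis.FluidPDE Literature.Analysis.FunctionSpaces

namespace Summit.NavierStokesRegularity.FluidComputer.VorticityRatioContinuation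

variable {d : Type*} [Fintype d] [DecidableEq d]

/-- **The enstrophy is continuous along a classical solution on `[0, T)`.** For a classical solution
`(u, p)` of the Navier–Stokes equations (any viscosity, any force) on `[0, T) × T^d`, `t ↦ ℰ(u(t))` is
continuous on `[0, T)`: on each closed sub-slab `[0, b]`, `b < T`, the enstrophy balance
(`IsClassicalNSSolutionOn.hasDerivWithinAt_half_gradNormSq`, Foias–Manley–Rosa–Temam (A.55)) gives a one-sided
derivative, hence continuity within `[0, b]`, and `[0, b]` is a neighbourhood of `s < b` within `[0, T)`.
[folklore] -/
theorem continuousOn_torusEnstrophy {ν T : ℝ} {f u : ℝ → UnitAddTorus d → EuclideanSpace ℝ d}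
    {p : ℝ → UnitAddTorus d → ℝ} (h : Torus.IsClassicalNSSolutionOn (Ico 0 T) ν f u p) :
    ContinuousOn (fun t => torusEnstrophy (u t)) (Ico 0 T) := by
  intro s hs
  set b : ℝ := (s + T) / 2 with hb
  have hsb : s < b := by rw [hb]; linarith [hs.2]
  have hbT : b < T := by rw [hb]; linarith [hs.2]
  have hb0 : 0 < b := lt_of_le_of_lt hs.1 hsb
  have hres : Torus.IsClassicalNSSolutionOn (Icc 0 b) ν f u p :=
    h.mono (fun t ht => ⟨ht.1, ht.2.trans_lt hbT⟩) (uniqueDiffOn_Icc hb0)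
  have hds : HasDerivWithinAt (fun r => torusEnstrophy (u r)) _ (Icc 0 b) s :=
    hres.hasDerivWithinAt_half_gradNormSq hb0 ⟨hs.1, hsb.le⟩
  refine hds.continuousWithinAt.mono_of_mem_nhdsWithin ?_
  exact mem_nhdsWithin.2 ⟨Iio b, isOpen_Iio, hsb, fun t ht => ⟨ht.2.1, le_of_lt ht.1⟩⟩

/-- **Continuation under an affine enstrophy majorant of the vorticity** (Beale–Kato–Majda on `T³`,
Robinson–Rodrigo–Sadowski 2016, Thm 12.3, with the energy identity). Let `(u, p)` be a classical solution of
the unforced Navier–Stokes equations with `ν > 0` on `[0, T) × T^d`, `card d = 3`, `T > 0`, with mean-zero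
velocity slices, and suppose `|ω(t, x)|² ≤ (K ℰ(u(t)) + C)²` for all `t ∈ [0, T)`, `x ∈ T^d`, with constants
`K, C ≥ 0`. Then the solution continues past `T` (a classical solution with mean-zero slices on some closed
`[0, T']`, `T' > T`, equal to `u` on `[0, T)`). Proof: the majorant `M(t) = K ℰ(u t) + C` is continuous
(`continuousOn_torusEnstrophy`), nonnegative, and `∫₀ᵗ M ≤ K ‖u(0)‖²/(4ν)·… + C T` — precisely
`∫₀ᵗ M ≤ K · (E(u 0)/(2ν)) + C T` by `two_mul_integral_torusEnstrophy_le_kineticEnergy` — so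
`Torus.classicalNS_bkm_continuation` applies. [cite: RobinsonRodrigoSadowskiCUP2016, Thm 12.3] -/
theorem continuation_of_vorticity_le_affine_enstrophy (hd : Fintype.card d = 3) {ν T : ℝ} (hν : 0 < ν)
    (hT : 0 < T) {u : ℝ → UnitAddTorus d → EuclideanSpace ℝ d} {p : ℝ → UnitAddTorus d → ℝ}
    (h : Torus.IsClassicalNSSolutionOn (Ico 0 T) ν 0 u p) (hmean : ∀ t ∈ Ico 0 T, Torus.HasZeroMean (u t))
    {K C : ℝ} (hK : 0 ≤ K) (hC : 0 ≤ C)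
    (hω : ∀ t ∈ Ico 0 T, ∀ x, torusVorticitySqAt (u t) x ≤ (K * torusEnstrophy (u t) + C) ^ 2) :
    ∃ T' : ℝ, T < T' ∧ ∃ (u' : ℝ → UnitAddTorus d → EuclideanSpace ℝ d) (p' : ℝ → UnitAddTorus d → ℝ),
      Torus.IsClassicalNSSolutionOn (Icc 0 T') ν 0 u' p' ∧ (∀ t ∈ Icc 0 T', Torus.HasZeroMean (u' t)) ∧
        ∀ t ∈ Ico 0 T, u' t = u t := by
  have hcont : ContinuousOn (fun t => K * torusEnstrophy (u t) + C) (Ico 0 T) :=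
    (continuousOn_const.mul (continuousOn_torusEnstrophy h)).add continuousOn_const
  refine Torus.classicalNS_bkm_continuation hd hν hT h hmean (M := fun t => K * torusEnstrophy (u t) + C)
    hcont (fun t _ => add_nonneg (mul_nonneg hK (torusEnstrophy_nonneg _)) hC) hω
    (I := K * (Torus.kineticEnergy (u 0) / (2 * ν)) + C * T) fun t ht => ?_
  -- the energy identity bounds the primitive of the enstrophy
  have hsub : Icc 0 t ⊆ Ico 0 T := fun s hs => ⟨hs.1, hs.2.trans_lt ht.2⟩
  have hbudget : 2 * ν * ∫ s in (0 : ℝ)..t, torusEnstrophy (u s) ≤ Torus.kineticEnergy (u 0) :=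
    two_mul_integral_torusEnstrophy_le_kineticEnergy h (convex_Ico 0 T) ht.1 hsub
  have hcontI : ContinuousOn (fun s => torusEnstrophy (u s)) (Icc 0 t) :=
    (continuousOn_torusEnstrophy h).mono hsub
  have hint : IntervalIntegrable (fun s => torusEnstrophy (u s)) volume 0 t :=
    (hcontI.mono (by rw [uIcc_of_le ht.1])).intervalIntegrable
  have h2ν : 0 < 2 * ν := by positivity
  have hE : ∫ s in (0 : ℝ)..t, torusEnstrophy (u s) ≤ Torus.kineticEnergy (u 0) / (2 * ν) := by
    rw [le_div_iff₀ h2ν, mul_comm]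
    exact hbudget
  calc ∫ s in (0 : ℝ)..t, (K * torusEnstrophy (u s) + C)
      = (K * ∫ s in (0 : ℝ)..t, torusEnstrophy (u s)) + C * t := by
        rw [intervalIntegral.integral_add (hint.const_mul K) intervalIntegrable_const,
          intervalIntegral.integral_const_mul, intervalIntegral.integral_const, smul_eq_mul, sub_zero,
          mul_comm (t : ℝ) C]
    _ ≤ K * (Torus.kineticEnergy (u 0) / (2 * ν)) + C * T :=
        add_le_add (mul_le_mul_of_nonneg_left hE hK) (mul_le_mul_of_nonneg_left ht.2.le hC)

/-- **Vorticity-ratio continuation — the statement typed by the idea-2 seat** (`VorticityRatioContinuation`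
of HOME/pub-fluidc-idea-2/SKETCH-R2-chessboard.lean, verbatim body; Robinson–Rodrigo–Sadowski 2016, Thm 12.3
on `T³`; Donzis et al. 2013: "any finite `D_m` is sufficient for regularity", `m = ∞` endpoint). A classical
mean-zero solution of unforced Navier–Stokes on `[0, T) × T³`, `ν > 0`, with `|ω(t, x)|² ≤ (K ℰ(u(t)))²` for
all `t ∈ [0, T)` and some `K ≥ 0`, continues past `T`. The case `C = 0` of
`continuation_of_vorticity_le_affine_enstrophy`. [cite: RobinsonRodrigoSadowskiCUP2016, Thm 12.3] -/
theorem vorticityRatioContinuation :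
    ∀ {d : Type} [Fintype d] [DecidableEq d], Fintype.card d = 3 →
    ∀ {ν T : ℝ}, 0 < ν → 0 < T →
    ∀ {u : ℝ → UnitAddTorus d → EuclideanSpace ℝ d} {p : ℝ → UnitAddTorus d → ℝ},
      Torus.IsClassicalNSSolutionOn (Ico 0 T) ν 0 u p →
      (∀ t ∈ Ico 0 T, Torus.HasZeroMean (u t)) →
      (∃ K : ℝ, 0 ≤ K ∧ ∀ t ∈ Ico 0 T, ∀ x, torusVorticitySqAt (u t) x ≤ (K * torusEnstrophy (u t)) ^ 2) →
      ∃ T' : ℝ, T < T' ∧ ∃ (u' : ℝ → UnitAddTorus d → EuclideanSpace ℝ d) (p' : ℝ → UnitAddTorus d → ℝ),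
        Torus.IsClassicalNSSolutionOn (Icc 0 T') ν 0 u' p' ∧ (∀ t ∈ Icc 0 T', Torus.HasZeroMean (u' t)) ∧
          ∀ t ∈ Ico 0 T, u' t = u t := by
  intro d _ _ hd ν T hν hT u p h hmean hK
  obtain ⟨K, hK0, hω⟩ := hK
  exact continuation_of_vorticity_le_affine_enstrophy hd hν hT h hmean hK0 le_rfl
    (fun t ht x => by simpa only [add_zero] using hω t ht x)

/-- **Vorticity-ratio floor (blow-up form, affine).** If a classical mean-zero solution of unforced
Navier–Stokes on `[0, T) × T³`, `ν > 0`, does NOT continue past `T` (no classical mean-zero solution on a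
closed `[0, T']`, `T' > T`, agreeing with it on `[0, T)`), then for all constants `K, C ≥ 0` some
`(t, x) ∈ [0, T) × T³` has `|ω(t, x)|² > (K ℰ(u(t)) + C)²`: the ratio `‖ω(t)‖_∞ / ℰ(u(t))` of the machine's
chessboard is unbounded on `[0, T)`, and stays so after removing any bounded early part `C`. Contrapositive
of `continuation_of_vorticity_le_affine_enstrophy`. [cite: RobinsonRodrigoSadowskiCUP2016, Thm 12.3] -/
theorem vorticityRatioFloor_affine (hd : Fintype.card d = 3) {ν T : ℝ} (hν : 0 < ν) (hT : 0 < T)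
    {u : ℝ → UnitAddTorus d → EuclideanSpace ℝ d} {p : ℝ → UnitAddTorus d → ℝ}
    (h : Torus.IsClassicalNSSolutionOn (Ico 0 T) ν 0 u p) (hmean : ∀ t ∈ Ico 0 T, Torus.HasZeroMean (u t))
    (hmax : ¬ ∃ T' : ℝ, T < T' ∧ ∃ (u' : ℝ → UnitAddTorus d → EuclideanSpace ℝ d)
      (p' : ℝ → UnitAddTorus d → ℝ), Torus.IsClassicalNSSolutionOn (Icc 0 T') ν 0 u' p' ∧
        (∀ t ∈ Icc 0 T', Torus.HasZeroMean (u' t)) ∧ ∀ t ∈ Ico 0 T, u' t = u t)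
    {K C : ℝ} (hK : 0 ≤ K) (hC : 0 ≤ C) :
    ∃ t ∈ Ico 0 T, ∃ x, (K * torusEnstrophy (u t) + C) ^ 2 < torusVorticitySqAt (u t) x := by
  by_contra hno
  push Not at hno
  exact hmax (continuation_of_vorticity_le_affine_enstrophy hd hν hT h hmean hK hC
    fun t ht x => hno t ht x)

/-- **The vorticity is bounded on every closed early slab.** For a classical solution `(u, p)` on
`[0, T) × T^d` and `0 < b < T` there is `C ≥ 0` with `|ω(t, x)|² ≤ C²` for all `t ∈ [0, b]`, `x ∈ T^d`: the
spatial derivatives `∂ᵢ u` are jointly smooth on `[0, b] × T^d` (`IsSmoothSpaceTimeOn.partialDeriv`), their sup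
norms are continuous in time (`IsSmoothSpaceTimeOn.continuousOn_toReal_eSupNorm`) hence bounded on the compact
`[0, b]`, and `|ω|² ≤ 2 ∑ᵢ ‖∂ᵢ u‖²` (`torusVorticitySqAt_le_two_mul_sum_norm_sq`). [folklore] -/
theorem exists_vorticitySq_le_on_Icc {ν T b : ℝ} {f u : ℝ → UnitAddTorus d → EuclideanSpace ℝ d}
    {p : ℝ → UnitAddTorus d → ℝ} (h : Torus.IsClassicalNSSolutionOn (Ico 0 T) ν f u p) (hb0 : 0 < b)
    (hbT : b < T) :
    ∃ C : ℝ, 0 ≤ C ∧ ∀ t ∈ Icc 0 b, ∀ x, torusVorticitySqAt (u t) x ≤ C ^ 2 := by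
  have hsub : Icc 0 b ⊆ Ico 0 T := fun t ht => ⟨ht.1, ht.2.trans_lt hbT⟩
  have hres : Torus.IsClassicalNSSolutionOn (Icc 0 b) ν f u p := h.mono hsub (uniqueDiffOn_Icc hb0)
  have hsm : Torus.IsSmoothSpaceTimeOn (Icc 0 b) u := hres.smooth_velocity
  -- a uniform bound on the sup norm of each spatial derivative over `[0, b]`
  have hB : ∀ i : d, ∃ B : ℝ, ∀ t ∈ Icc 0 b, ∀ x, ‖Torus.partialDeriv i (u t) x‖ ≤ B := by
    intro i
    have hDi : Torus.IsSmoothSpaceTimeOn (Icc 0 b) (fun t => Torus.partialDeriv i (u t)) :=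
      hsm.partialDeriv (uniqueDiffOn_Icc hb0) i
    obtain ⟨B, hBb⟩ := isCompact_Icc.exists_bound_of_continuousOn hDi.continuousOn_toReal_eSupNorm
    refine ⟨B, fun t ht x => ?_⟩
    have hc : Continuous (Torus.partialDeriv i (u t)) := (hDi.isSmooth_slice ht).continuous
    exact (Torus.norm_le_toReal_eSupNorm hc x).trans ((le_abs_self _).trans
      ((Real.norm_eq_abs _).symm.le.trans (hBb t ht)))
  choose B hBt using hB
  -- `|ω|² ≤ 2 ∑ᵢ ‖∂ᵢ u‖² ≤ 2 ∑ᵢ Bᵢ²`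
  refine ⟨Real.sqrt (2 * ∑ i, B i ^ 2), Real.sqrt_nonneg _, fun t ht x => ?_⟩
  have hS0 : 0 ≤ 2 * ∑ i, B i ^ 2 := by positivity
  rw [Real.sq_sqrt hS0]
  refine (torusVorticitySqAt_le_two_mul_sum_norm_sq (u t) x).trans ?_
  exact mul_le_mul_of_nonneg_left
    (Finset.sum_le_sum fun i _ => pow_le_pow_left₀ (norm_nonneg _) (hBt i t ht x) 2) (by norm_num)

/-- **Vorticity-ratio floor — the second statement typed by the idea-2 seat** (`VorticityRatioFloor` of
HOME/pub-fluidc-idea-2/SKETCH-R2-chessboard.lean, verbatim body; blow-up form of Robinson–Rodrigo–Sadowski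
2016, Thm 12.3 on `T³`). If a classical mean-zero solution of unforced Navier–Stokes on `[0, T) × T³`, `ν > 0`,
does NOT continue past `T`, then for every `K` and every `δ > 0` some `t ∈ [0, T)` with `T − δ ≤ t` and some
`x` satisfy `(K ℰ(u t))² < |ω(t, x)|²` — the ratio `‖ω(t)‖_∞ / ℰ(u(t))` is unbounded on every final segment
`[T − δ, T)`. Proof: otherwise `|ω|² ≤ (|K| ℰ + C)²` on all of `[0, T)` with `C` the vorticity bound of the
early slab `[0, T − δ]` (`exists_vorticitySq_le_on_Icc`; `C = 0` if `T ≤ δ`), and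
`continuation_of_vorticity_le_affine_enstrophy` continues the solution. [cite: RobinsonRodrigoSadowskiCUP2016, Thm 12.3] -/
theorem vorticityRatioFloor :
    ∀ {d : Type} [Fintype d] [DecidableEq d], Fintype.card d = 3 →
    ∀ {ν T : ℝ}, 0 < ν → 0 < T →
    ∀ {u : ℝ → UnitAddTorus d → EuclideanSpace ℝ d} {p : ℝ → UnitAddTorus d → ℝ},
      Torus.IsClassicalNSSolutionOn (Ico 0 T) ν 0 u p →
      (∀ t ∈ Ico 0 T, Torus.HasZeroMean (u t)) →
      (¬ ∃ T' : ℝ, T < T' ∧ ∃ (u' : ℝ → UnitAddTorus d → EuclideanSpace ℝ d) (p' : ℝ → UnitAddTorus d → ℝ),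
        Torus.IsClassicalNSSolutionOn (Icc 0 T') ν 0 u' p' ∧ (∀ t ∈ Icc 0 T', Torus.HasZeroMean (u' t)) ∧
          ∀ t ∈ Ico 0 T, u' t = u t) →
      ∀ K δ : ℝ, 0 < δ → ∃ t ∈ Ico 0 T, T - δ ≤ t ∧
        ∃ x, (K * torusEnstrophy (u t)) ^ 2 < torusVorticitySqAt (u t) x := by
  intro d _ _ hd ν T hν hT u p h hmean hmax K δ hδ
  by_contra hno
  push Not at hno
  -- `hno : ∀ t ∈ Ico 0 T, T - δ ≤ t → ∀ x, |ω|² ≤ (K ℰ)²`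
  -- the early slab `[0, T - δ]` (empty if `T ≤ δ`): a vorticity bound `C`
  obtain ⟨C, hC0, hCb⟩ : ∃ C : ℝ, 0 ≤ C ∧ ∀ t ∈ Ico 0 T, t < T - δ → ∀ x,
      torusVorticitySqAt (u t) x ≤ C ^ 2 := by
    rcases le_or_gt (T - δ) 0 with hle | hpos
    · exact ⟨0, le_rfl, fun t ht hlt => absurd (ht.1.trans_lt hlt) (not_lt.2 hle)⟩
    · obtain ⟨C, hC0, hCb⟩ := exists_vorticitySq_le_on_Icc h hpos (by linarith)
      exact ⟨C, hC0, fun t ht hlt x => hCb t ⟨ht.1, hlt.le⟩ x⟩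
  refine hmax (continuation_of_vorticity_le_affine_enstrophy hd hν hT h hmean (abs_nonneg K) hC0
    fun t ht x => ?_)
  have hE0 : 0 ≤ |K| * torusEnstrophy (u t) := mul_nonneg (abs_nonneg K) (torusEnstrophy_nonneg _)
  rcases lt_or_ge t (T - δ) with hlt | hge
  · -- early slab: `|ω|² ≤ C² ≤ (|K| ℰ + C)²`
    refine (hCb t ht hlt x).trans ?_
    exact pow_le_pow_left₀ hC0 (le_add_of_nonneg_left hE0) 2
  · -- final segment: `|ω|² ≤ (K ℰ)² = (|K| ℰ)² ≤ (|K| ℰ + C)²`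
    refine (hno t ht hge x).trans ?_
    have h1 : (K * torusEnstrophy (u t)) ^ 2 = (|K| * torusEnstrophy (u t)) ^ 2 := by
      rw [mul_pow, mul_pow, sq_abs]
    rw [h1]
    exact pow_le_pow_left₀ hE0 (le_add_of_nonneg_right hC0) 2

end Summit.NavierStokesRegularity.FluidComputer.VorticityRatioContinuation

end
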